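import Literature.Probability.LatticeModels.AFBetaDerivativeKernelBound
import Literature.Probability.LatticeModels.MagnetizationExponentUpperAFe
import Literature.Probability.LatticeModels.IsingTransport
import HarnessLib

/-!
# Aizenman–Fernández 1986, Theorem 5.6 on the discrete torus, from Lemma 5.5 for an abstract kernel

Topic `Probability/LatticeModels`, namespace `Literature.Probability.LatticeModels`. Sequel of
`AFBetaDerivativeKernelBound` (the random-current part of the proof of Aizenman–Fernández's
Theorem 5.6 for the `θ`-system) and of `MagnetizationExponentUpperAFe` (the torus quantities
`torusMag`, `torusSusc`, `torusBubble`).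

**Theorem 5.6** (Aizenman–Fernández 1986, (5.19), p. 431): in a finite translation-invariant
(periodic) ferromagnetic Ising system,
`∂M/∂β ≥ |M|J|χ - tanh(βh)|J|B₀χ|₊ / (1 + 2β|J|B₀)`, where (ibid. (5.20))
`∂M/∂β = ½ ∑_{u,v} J_{uv} ⟨σ₀; σ_uσ_v⟩` (derivative at constant `βh`). For the nearest-neighbour
model on the torus `(ℤ/Lℤ)^d` in the tree's parametrisation (coupling `β` on every edge, field `βh`)
the right-hand side of (5.20) is `torusDbeta d L β h = ½ ∑_u ∑_{v ∼ u} ⟨σ₀; σ_uσ_v⟩` (defined here;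
its identification with the `β`-derivative of `torusMag` is not needed and not proved), and
`|J| = ∑_x J_{0x}` is the degree `deg` of the torus graph.

`torusDbeta_mul_ge_of_kernel`: for every kernel `K : 𝕋 → 𝕋 → ℝ` with
* (K0) `0 ≤ K v k`,
* (K1) **Lemma 5.5** (ibid. (5.15)) for the bond sets touching the complement of a set `S ∋ g`:
  `⟨σ_v⟩ - ⟨σ_v⟩_S ≤ tanh(βh) ∑_{k ∉ S} K(v,k) + ∑_{k ∉ S} ∑_{l ∼ k} K(v,k) tanh(β) ⟨σ_l⟩_S`
  (`⟨·⟩_S = corrIn`, the system deprived of every bond not inside `S`),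
* (K2) `K(v,k) ≤ ⟨σ_vσ_k⟩_{h=0}` (ibid. Prop. 4.7, (4.22)),
one has `deg · χ_L · (M_L - tanh(βh) B_L) ≤ D_L · (1 + tanh(β) · deg · B_L)`, hence
(`torusDbeta_ge_of_kernel`) `D_L ≥ deg χ_L [M_L - tanh(βh) B_L]₊ / (1 + 2β deg B_L)`, the printed
(5.19). The walk kernel of AF86 §4 satisfies (K0)–(K2) (Lemma 5.5, Prop. 4.7); it is not
constructed here.

Proof: AF86 pp. 431–434 — `D = ∑_{(u,v)} afSZero 0 u v` ((3.16) symmetrised), the depletion bound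
(K1) inside `afSZero` ((5.23)), `I = M deg χ` ((5.24), translation invariance), the bound on `II` by
`sum_clusterWeight_notMem_le` and on `III` by `sum_clusterWeight_corrIn_notMem_le` (the corrected
(5.29)), and the bubble bound `∑_{(u,v)} K(v,k)⟨σ_uσ_k⟩_{h=0} ≤ deg B_L` (AM–GM in place of the
Schwarz inequality (5.26), with (K2) and translation invariance of the zero-field two-point function).

## References

* M. Aizenman, R. Fernández, J. Stat. Phys. **44** (1986) 393–454, §5.2, Theorem 5.6,
  eqs. (5.19)–(5.30), pp. 431–434; Lemma 5.5, (5.15), p. 429; Prop. 4.7, (4.22), p. 423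
  [AizenmanFernandezJSP1986].
* S. Friedli, Y. Velenik, *Statistical Mechanics of Lattice Systems*, CUP 2017, §3.1 (periodic
  boundary condition, translation invariance) [FriedliVelenik2017].
-/

noncomputable section

open Finset MeasureTheory
open scoped symmDiff ENNReal

namespace Literature.Probability.LatticeModels

section Torus

variable {d L : ℕ} [NeZero L]

local notation "𝕋" => TorusSite d L
local notation "GT" => torusGraph d L

variable (d L) in
/-- **The right-hand side of Aizenman–Fernández's (5.20) on the torus**:
`torusDbeta d L β h = ½ ∑_u ∑_{v ∼ u} (⟨σ₀σ_uσ_v⟩ - ⟨σ₀⟩⟨σ_uσ_v⟩)_{𝕋_L;β,h}` — the `β`-derivative of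
the magnetisation at constant `βh` ("`∂M/∂β = ½ ∑_{u,v} J_{uv} ⟨σ₀, σ_uσ_v⟩`", (5.20); here
`J_{uv} = 𝟙[u ∼ v]`, coupling `β` per edge). [cite: AizenmanFernandezJSP1986, §5.2, eq. (5.20), p. 431] -/
def torusDbeta (β h : ℝ) : ℝ :=
  (1 / 2) * ∑ u : 𝕋, ∑ v ∈ univ.filter ((torusGraph d L).Adj u),
    (isingCorr GT univ β h .plus ({(0 : 𝕋)} ∆ ({u} ∆ {v})) -
      isingCorr GT univ β h .plus {(0 : 𝕋)} * isingCorr GT univ β h .plus ({u} ∆ {v}))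

/-! ### Dictionary: torus states as `θ`-states -/

/-- On the whole torus the `+` state is the free state. [cite: FriedliVelenik2017, §3.1, Def. 3.2 (periodic boundary condition)] -/
theorem isingCorr_torus_plus_eq_free (β h : ℝ) (A : Finset 𝕋) :
    isingCorr GT univ β h .plus A = isingCorr GT univ β h .free A := by
  rw [isingCorr, isingCorr, show (BoundaryCondition.plus : BoundaryCondition 𝕋) = .fixed 1 from rfl,
    isingExpect_univ_fixed]

/-- The torus correlations are the `θ`-correlations at `θ = ghostCoupling β (βh)`. [cite: AizenmanFernandezJSP1986, §3.2, eqs. (3.6)–(3.7)] -/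
theorem isingCorr_torus_plus_eq_thetaCorr (β h : ℝ) (A : Finset 𝕋) :
    isingCorr GT univ β h .plus A = thetaCorr GT univ (ghostCoupling β (β * h)) A := by
  rw [isingCorr_torus_plus_eq_free, thetaCorr_ghostCoupling]

omit [NeZero L] in
/-- The zero-field couplings of `ghostCoupling β (βh)` are `ghostCoupling β (β·0)` (a local copy of
`zeroField_ghostCoupling` of `FieldCurrentsR2Bound`, to keep the imports small). [folklore] -/
private theorem zeroField_ghostCoupling_torus (β k : ℝ) :
    zeroField (ghostCoupling β k : Sym2 (Option 𝕋) → ℝ) = ghostCoupling β (β * 0) := by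
  funext e
  unfold zeroField ghostCoupling
  split_ifs <;> simp

/-- **The zero-field pair correlation of the `θ`-system is the periodic two-point function at `h = 0`.** [cite: AizenmanFernandezJSP1986, §4.3, Prop. 4.7, eq. (4.22) ("⟨σ_xσ_y⟩_{h=0}")] -/
theorem thetaCorr_zeroField_pair_eq (β h : ℝ) (u k : 𝕋) :
    thetaCorr GT univ (zeroField (ghostCoupling β (β * h))) ({u} ∆ {k}) = isingTorusTwoPoint d L β 0 u k := by
  rw [zeroField_ghostCoupling_torus, thetaCorr_ghostCoupling, isingTorusTwoPoint, isingTwoPoint_eq_isingCorr_symmDiff]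

/-- `torusMag` as a `θ`-correlation. [folklore] -/
theorem torusMag_eq_thetaCorr (β h : ℝ) :
    torusMag d L β h = thetaCorr GT univ (ghostCoupling β (β * h)) {(0 : 𝕋)} := by
  rw [torusMag, isingCorr_torus_plus_eq_thetaCorr]

/-- `torusSusc` as a sum of truncated `θ`-correlations. [folklore] -/
theorem torusSusc_eq_sum_thetaCorr (β h : ℝ) :
    torusSusc d L β h = ∑ y : 𝕋, (thetaCorr GT univ (ghostCoupling β (β * h)) ({(0 : 𝕋)} ∆ {y}) -
      thetaCorr GT univ (ghostCoupling β (β * h)) {(0 : 𝕋)} * thetaCorr GT univ (ghostCoupling β (β * h)) {y}) := by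
  unfold torusSusc
  refine sum_congr rfl fun y _ => ?_
  have e1 : isingExpect GT univ β h .plus (fun σ => spinAt 0 σ * spinAt y σ) = isingCorr GT univ β h .plus ({0} ∆ {y}) := by
    rw [← isingTwoPoint_eq_isingCorr_symmDiff]; rfl
  have e2 : ∀ z : 𝕋, isingExpect GT univ β h .plus (spinAt z) = isingCorr GT univ β h .plus {z} := fun z => by
    rw [isingCorr, spinProduct_singleton]
  rw [e1, e2, e2, isingCorr_torus_plus_eq_thetaCorr, isingCorr_torus_plus_eq_thetaCorr, isingCorr_torus_plus_eq_thetaCorr]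

/-- `torusDbeta` as a sum of truncated `θ`-correlations. [folklore] -/
theorem torusDbeta_eq_sum_thetaCorr (β h : ℝ) :
    torusDbeta d L β h = (1 / 2) * ∑ u : 𝕋, ∑ v ∈ univ.filter ((torusGraph d L).Adj u),
      (thetaCorr GT univ (ghostCoupling β (β * h)) ({(0 : 𝕋)} ∆ ({u} ∆ {v})) -
        thetaCorr GT univ (ghostCoupling β (β * h)) {(0 : 𝕋)} *
          thetaCorr GT univ (ghostCoupling β (β * h)) ({u} ∆ {v})) := by
  unfold torusDbeta
  simp only [isingCorr_torus_plus_eq_thetaCorr]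

/-! ### Translation invariance on the torus -/

omit [NeZero L] in
/-- Adjacency is invariant under translations: `u ∼ v ↔ 0 ∼ v - u`. [cite: FriedliVelenik2017, §3.1 (periodic boundary condition)] -/
theorem torusGraph_adj_iff_sub (u v : 𝕋) : (torusGraph d L).Adj u v ↔ (torusGraph d L).Adj 0 (v - u) := by
  have := torusGraph_adj_add_right (-u) u v
  rw [add_neg_cancel, ← sub_eq_add_neg] at this
  exact this.symm

/-- **The torus graph is regular**: every vertex has the degree of `0`. [cite: FriedliVelenik2017, §3.1 (periodic boundary condition)] -/
theorem card_filter_adj_eq (u : 𝕋) :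
    #(univ.filter ((torusGraph d L).Adj u)) = #(univ.filter ((torusGraph d L).Adj (0 : 𝕋))) := by
  have hmap : univ.filter ((torusGraph d L).Adj u) =
      (univ.filter ((torusGraph d L).Adj (0 : 𝕋))).map (Equiv.addRight u).toEmbedding := by
    ext v
    simp only [mem_filter, mem_univ, true_and, mem_map, Equiv.coe_toEmbedding, Equiv.coe_addRight]
    constructor
    · intro h
      exact ⟨v - u, (torusGraph_adj_iff_sub u v).1 h, sub_add_cancel v u⟩
    · rintro ⟨w, hw, rfl⟩
      rw [torusGraph_adj_iff_sub, add_sub_cancel_right]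
      exact hw
  rw [hmap, card_map]

/-- **Translation invariance of the one-point function**: `⟨σ_v⟩_{𝕋} = ⟨σ_0⟩_{𝕋}`. [cite: FriedliVelenik2017, §3.1 (periodic boundary condition, translation invariance)] -/
theorem thetaCorr_singleton_eq_zero_site (β h : ℝ) (v : 𝕋) :
    thetaCorr GT univ (ghostCoupling β (β * h)) {v} = thetaCorr GT univ (ghostCoupling β (β * h)) {(0 : 𝕋)} := by
  rw [thetaCorr_ghostCoupling, thetaCorr_ghostCoupling]
  have key := isingCorr_free_map (G := GT) (G' := GT) (Equiv.addRight v).toEmbedding (Λ := univ)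
    (fun x _ y _ => torusGraph_adj_add_right v x y) β h {(0 : 𝕋)}
  rw [Finset.map_univ_equiv, map_singleton] at key
  simp only [Equiv.coe_toEmbedding, Equiv.coe_addRight, zero_add] at key
  exact key

/-- **The zero-field bubble from any base point**: `∑_v ⟨σ_vσ_k⟩²_{h=0} = B_L` for every `k`
(translation invariance and symmetry of the periodic two-point function). [cite: AizenmanFernandezJSP1986, §5.2, proof of Thm. 5.6, eq. (5.26), p. 433] -/
theorem sum_isingTorusTwoPoint_sq_eq_torusBubble (β : ℝ) (k : 𝕋) :
    ∑ v : 𝕋, isingTorusTwoPoint d L β 0 v k ^ 2 = torusBubble d L β := by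
  unfold torusBubble
  have hshift : ∀ v : 𝕋, isingTorusTwoPoint d L β 0 v k = isingTorusTwoPoint d L β 0 0 (k - v) := by
    intro v
    have := isingTorusTwoPoint_add_right (d := d) (L := L) β 0 v (0 : 𝕋) (k - v)
    rw [zero_add, sub_add_cancel] at this
    exact this
  simp_rw [hshift]
  exact Fintype.sum_equiv (Equiv.subLeft k) _ _ fun v => rfl

/-! ### Theorem 5.6 from Lemma 5.5 -/

/-- Double sums over ordered adjacent pairs are symmetric: `∑_u ∑_{v ∼ u} f u v = ∑_u ∑_{v ∼ u} f v u`. [folklore] -/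
theorem sum_adj_comm (f : 𝕋 → 𝕋 → ℝ) :
    ∑ u : 𝕋, ∑ v ∈ univ.filter ((torusGraph d L).Adj u), f u v =
      ∑ u : 𝕋, ∑ v ∈ univ.filter ((torusGraph d L).Adj u), f v u := by
  simp_rw [sum_filter]
  rw [sum_comm]
  refine sum_congr rfl fun u _ => sum_congr rfl fun v _ => ?_
  by_cases h : (torusGraph d L).Adj v u
  · rw [if_pos h, if_pos ((torusGraph d L).adj_symm h)]
  · rw [if_neg h, if_neg (fun h' => h ((torusGraph d L).adj_symm h'))]

/-- **`torusDbeta` as the edge sum of `afSZero`** ((3.16) symmetrised, (5.21): "By symmetry the sum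
for the permuted term is identical to the sum for the first term, hence its net effect is to remove
the factor `1/2`"). [cite: AizenmanFernandezJSP1986, §5.2, proof of Thm. 5.6, eq. (5.21), p. 431] -/
theorem torusDbeta_eq_sum_afSZero {β h : ℝ} (hβ : 0 ≤ β) (hh : 0 ≤ h) :
    torusDbeta d L β h = ∑ u : 𝕋, ∑ v ∈ univ.filter ((torusGraph d L).Adj u),
      afSZero GT univ (ghostCoupling β (β * h)) 0 u v := by
  have hθ : ∀ e, 0 ≤ (ghostCoupling β (β * h) : Sym2 (Option 𝕋) → ℝ) e :=
    ghostCoupling_nonneg hβ (mul_nonneg hβ hh)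
  rw [torusDbeta_eq_sum_thetaCorr]
  have h316 : ∀ u : 𝕋, ∀ v ∈ univ.filter ((torusGraph d L).Adj u),
      thetaCorr GT univ (ghostCoupling β (β * h)) ({(0 : 𝕋)} ∆ ({u} ∆ {v})) -
          thetaCorr GT univ (ghostCoupling β (β * h)) {(0 : 𝕋)} * thetaCorr GT univ (ghostCoupling β (β * h)) ({u} ∆ {v}) =
        afSZero GT univ (ghostCoupling β (β * h)) 0 u v + afSZero GT univ (ghostCoupling β (β * h)) 0 v u := by
    intro u v hv
    have huv : u ≠ v := (torusGraph d L).ne_of_adj (mem_filter.1 hv).2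
    exact thetaCorr_triple_sub_eq_afSZero_add hθ (mem_univ _) (mem_univ _) (mem_univ _) huv
  rw [sum_congr rfl fun u _ => sum_congr rfl (h316 u)]
  simp_rw [sum_add_distrib]
  rw [← sum_adj_comm (fun u v => afSZero GT univ (ghostCoupling β (β * h)) 0 u v)]
  ring

/-- `torusDbeta ≥ 0` (GKS II: `⟨σ₀; σ_uσ_v⟩ ≥ 0`). [cite: FriedliVelenik2017, Thm. 3.20, eq. (3.22) (GKS II)] -/
theorem torusDbeta_nonneg {β h : ℝ} (hβ : 0 ≤ β) (hh : 0 ≤ h) : 0 ≤ torusDbeta d L β h := by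
  rw [torusDbeta_eq_sum_afSZero hβ hh]
  exact sum_nonneg fun u _ => sum_nonneg fun v _ =>
    afSZero_nonneg (ghostCoupling_nonneg hβ (mul_nonneg hβ hh)) 0 u (mem_univ v)

/-- **The bubble bound** (AM–GM form of the Schwarz inequality (5.26)): for a kernel
`0 ≤ K(v,k) ≤ ⟨σ_vσ_k⟩_{h=0}` and every `k`,
`∑_u ∑_{v ∼ u} K(v,k) ⟨σ_uσ_k⟩_{h=0} ≤ deg · B_L`. [cite: AizenmanFernandezJSP1986, §5.2, proof of Thm. 5.6, eq. (5.26), p. 433] -/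
theorem sum_adj_kernel_mul_twoPoint_le {β : ℝ} {K : 𝕋 → 𝕋 → ℝ} (hK0 : ∀ v k, 0 ≤ K v k)
    (hK2 : ∀ v k, K v k ≤ isingTorusTwoPoint d L β 0 v k) (k : 𝕋) :
    ∑ u : 𝕋, ∑ v ∈ univ.filter ((torusGraph d L).Adj u), K v k * isingTorusTwoPoint d L β 0 u k ≤
      ((univ.filter ((torusGraph d L).Adj (0 : 𝕋))).card : ℝ) * torusBubble d L β := by
  set G₀ : 𝕋 → ℝ := fun v => isingTorusTwoPoint d L β 0 v k with hG₀
  set deg : ℝ := ((univ.filter ((torusGraph d L).Adj (0 : 𝕋))).card : ℝ) with hdeg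
  have hamgm : ∀ u v : 𝕋, K v k * G₀ u ≤ (G₀ v ^ 2 + G₀ u ^ 2) / 2 := by
    intro u v
    have h1 : K v k ^ 2 ≤ G₀ v ^ 2 := pow_le_pow_left₀ (hK0 v k) (hK2 v k) 2
    nlinarith [sq_nonneg (K v k - G₀ u)]
  calc ∑ u : 𝕋, ∑ v ∈ univ.filter ((torusGraph d L).Adj u), K v k * isingTorusTwoPoint d L β 0 u k
      ≤ ∑ u : 𝕋, ∑ v ∈ univ.filter ((torusGraph d L).Adj u), (G₀ v ^ 2 + G₀ u ^ 2) / 2 :=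
        sum_le_sum fun u _ => sum_le_sum fun v _ => hamgm u v
    _ = (1 / 2) * (∑ u : 𝕋, ∑ v ∈ univ.filter ((torusGraph d L).Adj u), G₀ v ^ 2) +
          (1 / 2) * (∑ u : 𝕋, ∑ v ∈ univ.filter ((torusGraph d L).Adj u), G₀ u ^ 2) := by
        rw [mul_sum, mul_sum, ← sum_add_distrib]
        refine sum_congr rfl fun u _ => ?_
        rw [mul_sum, mul_sum, ← sum_add_distrib]
        exact sum_congr rfl fun v _ => by ring
    _ = (1 / 2) * (∑ u : 𝕋, ∑ v ∈ univ.filter ((torusGraph d L).Adj u), G₀ u ^ 2) +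
          (1 / 2) * (∑ u : 𝕋, ∑ v ∈ univ.filter ((torusGraph d L).Adj u), G₀ u ^ 2) := by
        rw [sum_adj_comm (fun u v => G₀ v ^ 2)]
    _ = deg * ∑ u : 𝕋, G₀ u ^ 2 := by
        have hc : ∀ u : 𝕋, ∑ v ∈ univ.filter ((torusGraph d L).Adj u), G₀ u ^ 2 = deg * G₀ u ^ 2 := by
          intro u
          rw [sum_const, card_filter_adj_eq u, nsmul_eq_mul]
        simp_rw [hc]
        rw [← mul_sum]
        ring
    _ = deg * torusBubble d L β := by rw [sum_isingTorusTwoPoint_sq_eq_torusBubble]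

/-! ### Finite-sum algebra -/

omit [NeZero L] in
/-- Exchange of a sum over sets `S` with a sum over the sites outside `S`. [folklore] -/
theorem sum_mul_sum_filter_notMem_comm {ι : Type*} [Fintype ι] [DecidableEq ι] (P : Finset (Finset (Option ι)))
    (f : Finset (Option ι) → ℝ) (g : ι → ℝ) :
    ∑ S ∈ P, f S * ∑ k ∈ univ.filter (fun k : ι => (some k : Option ι) ∉ S), g k =
      ∑ k : ι, g k * ∑ S ∈ P.filter (fun S => (some k : Option ι) ∉ S), f S := by
  calc ∑ S ∈ P, f S * ∑ k ∈ univ.filter (fun k : ι => (some k : Option ι) ∉ S), g k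
      = ∑ S ∈ P, ∑ k : ι, (if (some k : Option ι) ∉ S then f S * g k else 0) := by
        refine sum_congr rfl fun S _ => ?_
        rw [mul_sum, sum_filter]
    _ = ∑ k : ι, ∑ S ∈ P, (if (some k : Option ι) ∉ S then f S * g k else 0) := sum_comm
    _ = ∑ k : ι, g k * ∑ S ∈ P.filter (fun S => (some k : Option ι) ∉ S), f S := by
        refine sum_congr rfl fun k _ => ?_
        rw [sum_filter, mul_sum]
        exact sum_congr rfl fun S _ => by split_ifs <;> simp [mul_comm]

omit [NeZero L] in
/-- The same exchange with an inner sum over neighbours. [folklore] -/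
theorem sum_mul_sum_filter_notMem_sum_comm {ι : Type*} [Fintype ι] [DecidableEq ι] (P : Finset (Finset (Option ι)))
    (f : Finset (Option ι) → ℝ) (c : Finset (Option ι) → ι → ℝ) (g : ι → ι → ℝ) (A : ι → Finset ι) :
    ∑ S ∈ P, f S * ∑ k ∈ univ.filter (fun k : ι => (some k : Option ι) ∉ S), ∑ l ∈ A k, g k l * c S l =
      ∑ k : ι, ∑ l ∈ A k, g k l * ∑ S ∈ P.filter (fun S => (some k : Option ι) ∉ S), f S * c S l := by
  calc ∑ S ∈ P, f S * ∑ k ∈ univ.filter (fun k : ι => (some k : Option ι) ∉ S), ∑ l ∈ A k, g k l * c S l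
      = ∑ S ∈ P, ∑ k : ι, (if (some k : Option ι) ∉ S then ∑ l ∈ A k, f S * (g k l * c S l) else 0) := by
        refine sum_congr rfl fun S _ => ?_
        rw [mul_sum, sum_filter]
        exact sum_congr rfl fun k _ => by split_ifs <;> simp [mul_sum]
    _ = ∑ k : ι, ∑ S ∈ P, (if (some k : Option ι) ∉ S then ∑ l ∈ A k, f S * (g k l * c S l) else 0) := sum_comm
    _ = ∑ k : ι, ∑ S ∈ P.filter (fun S => (some k : Option ι) ∉ S), ∑ l ∈ A k, f S * (g k l * c S l) := by
        refine sum_congr rfl fun k _ => ?_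
        rw [sum_filter]
    _ = ∑ k : ι, ∑ l ∈ A k, ∑ S ∈ P.filter (fun S => (some k : Option ι) ∉ S), f S * (g k l * c S l) :=
        sum_congr rfl fun k _ => sum_comm
    _ = ∑ k : ι, ∑ l ∈ A k, g k l * ∑ S ∈ P.filter (fun S => (some k : Option ι) ∉ S), f S * c S l := by
        refine sum_congr rfl fun k _ => sum_congr rfl fun l _ => ?_
        rw [mul_sum]
        exact sum_congr rfl fun S _ => by ring

omit [NeZero L] in
/-- Reordering a triple sum. [folklore] -/
theorem sum_mul_sum_sum_comm₃ {ι : Type*} [Fintype ι] (tp : ι → ℝ) (K G₀ : ι → ι → ℝ) (A : ι → Finset ι) :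
    ∑ k : ι, tp k * ∑ u : ι, ∑ v ∈ A u, K v k * G₀ u k =
      ∑ u : ι, ∑ v ∈ A u, ∑ k : ι, K v k * (G₀ u k * tp k) := by
  calc ∑ k : ι, tp k * ∑ u : ι, ∑ v ∈ A u, K v k * G₀ u k
      = ∑ k : ι, ∑ u : ι, ∑ v ∈ A u, K v k * (G₀ u k * tp k) := by
        refine sum_congr rfl fun k _ => ?_
        rw [mul_sum]
        refine sum_congr rfl fun u _ => ?_
        rw [mul_sum]
        exact sum_congr rfl fun v _ => by ring
    _ = ∑ u : ι, ∑ k : ι, ∑ v ∈ A u, K v k * (G₀ u k * tp k) := sum_comm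
    _ = ∑ u : ι, ∑ v ∈ A u, ∑ k : ι, K v k * (G₀ u k * tp k) := sum_congr rfl fun u _ => sum_comm

omit [NeZero L] in
/-- Reordering a fourfold sum. [folklore] -/
theorem sum_sum_mul_sum_sum_comm₄ {ι : Type*} [Fintype ι] (a K G₀ : ι → ι → ℝ) (A : ι → Finset ι) :
    ∑ k : ι, ∑ l ∈ A k, a k l * ∑ u : ι, ∑ v ∈ A u, K v k * G₀ u k =
      ∑ u : ι, ∑ v ∈ A u, ∑ k : ι, ∑ l ∈ A k, K v k * (G₀ u k * a k l) := by
  calc ∑ k : ι, ∑ l ∈ A k, a k l * ∑ u : ι, ∑ v ∈ A u, K v k * G₀ u k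
      = ∑ k : ι, ∑ l ∈ A k, ∑ u : ι, ∑ v ∈ A u, K v k * (G₀ u k * a k l) := by
        refine sum_congr rfl fun k _ => sum_congr rfl fun l _ => ?_
        rw [mul_sum]
        refine sum_congr rfl fun u _ => ?_
        rw [mul_sum]
        exact sum_congr rfl fun v _ => by ring
    _ = ∑ k : ι, ∑ u : ι, ∑ l ∈ A k, ∑ v ∈ A u, K v k * (G₀ u k * a k l) := sum_congr rfl fun k _ => sum_comm
    _ = ∑ u : ι, ∑ k : ι, ∑ l ∈ A k, ∑ v ∈ A u, K v k * (G₀ u k * a k l) := sum_comm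
    _ = ∑ u : ι, ∑ k : ι, ∑ v ∈ A u, ∑ l ∈ A k, K v k * (G₀ u k * a k l) :=
        sum_congr rfl fun u _ => sum_congr rfl fun k _ => sum_comm
    _ = ∑ u : ι, ∑ v ∈ A u, ∑ k : ι, ∑ l ∈ A k, K v k * (G₀ u k * a k l) := sum_congr rfl fun u _ => sum_comm

/-- **Aizenman–Fernández 1986, Theorem 5.6, on the torus, from Lemma 5.5 for an abstract kernel.**
For the nearest-neighbour Ising model on `(ℤ/Lℤ)^d` at `β, h ≥ 0` (tree parametrisation) and any
kernel `K` with (K0) `K ≥ 0`, (K1) the depletion bound of Lemma 5.5 ((5.15)) for the bond sets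
touching the complement of the sets `S ∋ g`, and (K2) `K(v,k) ≤ ⟨σ_vσ_k⟩_{h=0}` ((4.22)):
`deg · χ_L · (M_L - tanh(βh) B_L) ≤ D_L · (1 + tanh(β) · deg · B_L)`
(`deg` = degree of the torus graph, `D_L = torusDbeta`, the right-hand side of (5.20)). Proof as
printed, (5.21)–(5.30), with the random-current steps of `AFBetaDerivativeKernelBound`. [cite: AizenmanFernandezJSP1986, §5.2, Theorem 5.6, eqs. (5.19)–(5.30), pp. 431–434] -/
theorem torusDbeta_mul_ge_of_kernel {β h : ℝ} (hβ : 0 ≤ β) (hh : 0 ≤ h) (K : 𝕋 → 𝕋 → ℝ)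
    (hK0 : ∀ v k, 0 ≤ K v k)
    (hK1 : ∀ S : Finset (Option 𝕋), (none : Option 𝕋) ∈ S → ∀ v : 𝕋,
      thetaCorr GT univ (ghostCoupling β (β * h)) {v} - corrIn GT univ (ghostCoupling β (β * h)) S {v} ≤
        Real.tanh (β * h) * ∑ k ∈ univ.filter (fun k : 𝕋 => (some k : Option 𝕋) ∉ S), K v k +
          ∑ k ∈ univ.filter (fun k : 𝕋 => (some k : Option 𝕋) ∉ S),
            ∑ l ∈ univ.filter ((torusGraph d L).Adj k),
              K v k * Real.tanh β * corrIn GT univ (ghostCoupling β (β * h)) S {l})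
    (hK2 : ∀ v k, K v k ≤ isingTorusTwoPoint d L β 0 v k) :
    ((univ.filter ((torusGraph d L).Adj (0 : 𝕋))).card : ℝ) * torusSusc d L β h *
        (torusMag d L β h - Real.tanh (β * h) * torusBubble d L β) ≤
      torusDbeta d L β h * (1 + Real.tanh β * ((univ.filter ((torusGraph d L).Adj (0 : 𝕋))).card : ℝ) * torusBubble d L β) := by
  classical
  -- notation
  set θ : Sym2 (Option 𝕋) → ℝ := ghostCoupling β (β * h) with hθdef
  have hθ : ∀ e, 0 ≤ θ e := ghostCoupling_nonneg hβ (mul_nonneg hβ hh)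
  set P : Finset (Finset (Option 𝕋)) :=
    (Finset.insertNone (univ : Finset 𝕋)).powerset.filter (fun S => (none : Option 𝕋) ∈ S) with hP
  set deg : ℝ := ((univ.filter ((torusGraph d L).Adj (0 : 𝕋))).card : ℝ) with hdeg
  set M : ℝ := torusMag d L β h with hM
  set χ : ℝ := torusSusc d L β h with hχ
  set B : ℝ := torusBubble d L β with hB
  set D : ℝ := torusDbeta d L β h with hD
  have hth0 : 0 ≤ Real.tanh (β * h) := by
    rw [Real.tanh_eq_sinh_div_cosh]
    exact div_nonneg (Real.sinh_nonneg_iff.2 (mul_nonneg hβ hh)) (Real.cosh_pos _).le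
  have htb0 : 0 ≤ Real.tanh β := by
    rw [Real.tanh_eq_sinh_div_cosh]
    exact div_nonneg (Real.sinh_nonneg_iff.2 hβ) (Real.cosh_pos _).le
  have hB0 : 0 ≤ B := sum_nonneg fun y _ => sq_nonneg _
  -- the truncated pair function `tp k = ⟨σ₀;σ_k⟩ ≥ 0` and `χ = ∑ tp`
  have htp0 : ∀ k : 𝕋, 0 ≤ thetaCorr GT univ θ ({(0 : 𝕋)} ∆ {k}) - thetaCorr GT univ θ {(0 : 𝕋)} * thetaCorr GT univ θ {k} := by
    intro k
    rw [hθdef, thetaCorr_ghostCoupling, thetaCorr_ghostCoupling, thetaCorr_ghostCoupling, sub_nonneg]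
    have := GKSInequalities.gks_two_holds GT (Λ := univ) (A := {(0 : 𝕋)}) (B := {k}) hβ hh (Or.inl rfl)
      (subset_univ _) (subset_univ _)
    simpa only [mul_comm] using this
  have hχ' : χ = ∑ k : 𝕋, (thetaCorr GT univ θ ({(0 : 𝕋)} ∆ {k}) - thetaCorr GT univ θ {(0 : 𝕋)} * thetaCorr GT univ θ {k}) := by
    rw [hχ, torusSusc_eq_sum_thetaCorr]
  have hMv : ∀ v : 𝕋, thetaCorr GT univ θ {v} = M := fun v => by
    rw [hM, torusMag_eq_thetaCorr, hθdef, thetaCorr_singleton_eq_zero_site]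
  have hG₀θ : ∀ u k : 𝕋, thetaCorr GT univ (zeroField θ) ({u} ∆ {k}) = isingTorusTwoPoint d L β 0 u k := fun u k => by
    rw [hθdef, thetaCorr_zeroField_pair_eq]
  have hW : ∀ k, ∑ u : 𝕋, ∑ v ∈ univ.filter ((torusGraph d L).Adj u), K v k * isingTorusTwoPoint d L β 0 u k ≤ deg * B :=
    fun k => sum_adj_kernel_mul_twoPoint_le hK0 hK2 k
  have hD' : D = ∑ u : 𝕋, ∑ v ∈ univ.filter ((torusGraph d L).Adj u), afSZero GT univ θ 0 u v :=
    torusDbeta_eq_sum_afSZero hβ hh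
  have hAcard : ∀ u : 𝕋, (#(univ.filter ((torusGraph d L).Adj u)) : ℝ) = deg := fun u => by rw [hdeg, card_filter_adj_eq u]
  have hfilt : ∀ k : 𝕋, (Finset.insertNone (univ : Finset 𝕋)).powerset.filter
      (fun S => (none : Option 𝕋) ∈ S ∧ (some k : Option 𝕋) ∉ S) = P.filter (fun S => (some k : Option 𝕋) ∉ S) :=
    fun k => by rw [hP, filter_filter]
  -- Step 1: the depletion bound inside `afSZero`
  have step1 : ∀ u v : 𝕋, ∑ S ∈ P, clusterWeight GT univ θ 0 u S *
      (M - (Real.tanh (β * h) * ∑ k ∈ univ.filter (fun k : 𝕋 => (some k : Option 𝕋) ∉ S), K v k +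
        ∑ k ∈ univ.filter (fun k : 𝕋 => (some k : Option 𝕋) ∉ S), ∑ l ∈ univ.filter ((torusGraph d L).Adj k),
          K v k * Real.tanh β * corrIn GT univ θ S {l})) ≤ afSZero GT univ θ 0 u v := by
    intro u v
    unfold afSZero
    refine sum_le_sum fun S hS => mul_le_mul_of_nonneg_left ?_ (clusterWeight_nonneg θ 0 u S)
    have hnS : (none : Option 𝕋) ∈ S := (mem_filter.1 hS).2
    have := hK1 S hnS v
    rw [hMv v] at this
    linarith
  -- Step 2: term I
  have stepI : ∑ u : 𝕋, ∑ v ∈ univ.filter ((torusGraph d L).Adj u), ∑ S ∈ P, clusterWeight GT univ θ 0 u S * M =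
      M * deg * χ := by
    have hin : ∀ u : 𝕋, ∑ S ∈ P, clusterWeight GT univ θ 0 u S * M =
        M * (thetaCorr GT univ θ ({(0 : 𝕋)} ∆ {u}) - thetaCorr GT univ θ {(0 : 𝕋)} * thetaCorr GT univ θ {u}) := fun u => by
      rw [← sum_mul, sum_clusterWeight_none_eq hθ (mem_univ _) (mem_univ _), mul_comm]
    have hmid : ∀ u : 𝕋, ∑ v ∈ univ.filter ((torusGraph d L).Adj u), ∑ S ∈ P, clusterWeight GT univ θ 0 u S * M =
        deg * (M * (thetaCorr GT univ θ ({(0 : 𝕋)} ∆ {u}) - thetaCorr GT univ θ {(0 : 𝕋)} * thetaCorr GT univ θ {u})) := by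
      intro u
      rw [hin u, sum_const, nsmul_eq_mul, hAcard u]
    rw [sum_congr rfl fun u _ => hmid u, ← mul_sum, hχ', mul_sum, mul_sum, ← mul_sum]
    simp only [mul_sum]
    exact sum_congr rfl fun u _ => by ring
  -- Step 3: term II
  have stepII : ∑ u : 𝕋, ∑ v ∈ univ.filter ((torusGraph d L).Adj u), ∑ S ∈ P, clusterWeight GT univ θ 0 u S *
      (Real.tanh (β * h) * ∑ k ∈ univ.filter (fun k : 𝕋 => (some k : Option 𝕋) ∉ S), K v k) ≤
      Real.tanh (β * h) * deg * B * χ := by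
    have hbound : ∀ u v : 𝕋, ∑ S ∈ P, clusterWeight GT univ θ 0 u S *
        (Real.tanh (β * h) * ∑ k ∈ univ.filter (fun k : 𝕋 => (some k : Option 𝕋) ∉ S), K v k) ≤
        Real.tanh (β * h) * ∑ k : 𝕋, K v k * (isingTorusTwoPoint d L β 0 u k *
          (thetaCorr GT univ θ ({(0 : 𝕋)} ∆ {k}) - thetaCorr GT univ θ {(0 : 𝕋)} * thetaCorr GT univ θ {k})) := by
      intro u v
      have hex : ∑ S ∈ P, clusterWeight GT univ θ 0 u S *
          (Real.tanh (β * h) * ∑ k ∈ univ.filter (fun k : 𝕋 => (some k : Option 𝕋) ∉ S), K v k) =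
          Real.tanh (β * h) * ∑ k : 𝕋, K v k * ∑ S ∈ P.filter (fun S => (some k : Option 𝕋) ∉ S), clusterWeight GT univ θ 0 u S := by
        rw [← sum_mul_sum_filter_notMem_comm P (fun S => clusterWeight GT univ θ 0 u S) (K v), mul_sum]
        exact sum_congr rfl fun S _ => by ring
      rw [hex]
      refine mul_le_mul_of_nonneg_left (sum_le_sum fun k _ => mul_le_mul_of_nonneg_left ?_ (hK0 v k)) hth0
      have := sum_clusterWeight_notMem_le (G := GT) (Λ := univ) hθ (o := (0 : 𝕋)) (u := u) (k := k)
        (mem_univ _) (mem_univ _) (mem_univ _)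
      rw [hfilt k, hG₀θ] at this
      exact this
    refine (sum_le_sum fun u _ => sum_le_sum fun v _ => hbound u v).trans ?_
    rw [show ∑ u : 𝕋, ∑ v ∈ univ.filter ((torusGraph d L).Adj u), Real.tanh (β * h) * ∑ k : 𝕋, K v k *
        (isingTorusTwoPoint d L β 0 u k * (thetaCorr GT univ θ ({(0 : 𝕋)} ∆ {k}) - thetaCorr GT univ θ {(0 : 𝕋)} * thetaCorr GT univ θ {k})) =
        Real.tanh (β * h) * ∑ k : 𝕋, (thetaCorr GT univ θ ({(0 : 𝕋)} ∆ {k}) - thetaCorr GT univ θ {(0 : 𝕋)} * thetaCorr GT univ θ {k}) *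
          ∑ u : 𝕋, ∑ v ∈ univ.filter ((torusGraph d L).Adj u), K v k * isingTorusTwoPoint d L β 0 u k by
      rw [sum_mul_sum_sum_comm₃, mul_sum]
      exact sum_congr rfl fun u _ => by rw [mul_sum]]
    have : ∑ k : 𝕋, (thetaCorr GT univ θ ({(0 : 𝕋)} ∆ {k}) - thetaCorr GT univ θ {(0 : 𝕋)} * thetaCorr GT univ θ {k}) *
        ∑ u : 𝕋, ∑ v ∈ univ.filter ((torusGraph d L).Adj u), K v k * isingTorusTwoPoint d L β 0 u k ≤
        ∑ k : 𝕋, (thetaCorr GT univ θ ({(0 : 𝕋)} ∆ {k}) - thetaCorr GT univ θ {(0 : 𝕋)} * thetaCorr GT univ θ {k}) * (deg * B) :=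
      sum_le_sum fun k _ => mul_le_mul_of_nonneg_left (hW k) (htp0 k)
    rw [← sum_mul, ← hχ'] at this
    nlinarith [this, hth0]
  -- Step 4: term III
  have stepIII : ∑ u : 𝕋, ∑ v ∈ univ.filter ((torusGraph d L).Adj u), ∑ S ∈ P, clusterWeight GT univ θ 0 u S *
      (∑ k ∈ univ.filter (fun k : 𝕋 => (some k : Option 𝕋) ∉ S), ∑ l ∈ univ.filter ((torusGraph d L).Adj k),
        K v k * Real.tanh β * corrIn GT univ θ S {l}) ≤ Real.tanh β * deg * B * D := by
    have hbound : ∀ u v : 𝕋, ∑ S ∈ P, clusterWeight GT univ θ 0 u S *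
        (∑ k ∈ univ.filter (fun k : 𝕋 => (some k : Option 𝕋) ∉ S), ∑ l ∈ univ.filter ((torusGraph d L).Adj k),
          K v k * Real.tanh β * corrIn GT univ θ S {l}) ≤
        Real.tanh β * ∑ k : 𝕋, ∑ l ∈ univ.filter ((torusGraph d L).Adj k),
          K v k * (isingTorusTwoPoint d L β 0 u k * afSZero GT univ θ 0 k l) := by
      intro u v
      have hex : ∑ S ∈ P, clusterWeight GT univ θ 0 u S *
          (∑ k ∈ univ.filter (fun k : 𝕋 => (some k : Option 𝕋) ∉ S), ∑ l ∈ univ.filter ((torusGraph d L).Adj k),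
            K v k * Real.tanh β * corrIn GT univ θ S {l}) =
          Real.tanh β * ∑ k : 𝕋, ∑ l ∈ univ.filter ((torusGraph d L).Adj k), K v k *
            ∑ S ∈ P.filter (fun S => (some k : Option 𝕋) ∉ S), clusterWeight GT univ θ 0 u S * corrIn GT univ θ S {l} := by
        rw [sum_mul_sum_filter_notMem_sum_comm P (fun S => clusterWeight GT univ θ 0 u S) (fun S l => corrIn GT univ θ S {l})
          (fun k l => K v k * Real.tanh β) (fun k => univ.filter ((torusGraph d L).Adj k)), mul_sum]
        refine sum_congr rfl fun k _ => ?_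
        rw [mul_sum]
        exact sum_congr rfl fun l _ => by ring
      rw [hex]
      refine mul_le_mul_of_nonneg_left (sum_le_sum fun k _ => sum_le_sum fun l hl =>
        mul_le_mul_of_nonneg_left ?_ (hK0 v k)) htb0
      have hkl : k ≠ l := (torusGraph d L).ne_of_adj (mem_filter.1 hl).2
      have := sum_clusterWeight_corrIn_notMem_le (G := GT) (Λ := univ) hθ (o := (0 : 𝕋)) (u := u) (k := k) (l := l)
        (mem_univ _) (mem_univ _) (mem_univ _) (mem_univ _) hkl
      rw [hfilt k, hG₀θ] at this
      exact this
    refine (sum_le_sum fun u _ => sum_le_sum fun v _ => hbound u v).trans ?_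
    rw [show ∑ u : 𝕋, ∑ v ∈ univ.filter ((torusGraph d L).Adj u), Real.tanh β * ∑ k : 𝕋,
        ∑ l ∈ univ.filter ((torusGraph d L).Adj k), K v k * (isingTorusTwoPoint d L β 0 u k * afSZero GT univ θ 0 k l) =
        Real.tanh β * ∑ k : 𝕋, ∑ l ∈ univ.filter ((torusGraph d L).Adj k), afSZero GT univ θ 0 k l *
          ∑ u : 𝕋, ∑ v ∈ univ.filter ((torusGraph d L).Adj u), K v k * isingTorusTwoPoint d L β 0 u k by
      rw [sum_sum_mul_sum_sum_comm₄, mul_sum]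
      exact sum_congr rfl fun u _ => by rw [mul_sum]]
    have : ∑ k : 𝕋, ∑ l ∈ univ.filter ((torusGraph d L).Adj k), afSZero GT univ θ 0 k l *
          ∑ u : 𝕋, ∑ v ∈ univ.filter ((torusGraph d L).Adj u), K v k * isingTorusTwoPoint d L β 0 u k ≤
        ∑ k : 𝕋, ∑ l ∈ univ.filter ((torusGraph d L).Adj k), afSZero GT univ θ 0 k l * (deg * B) :=
      sum_le_sum fun k _ => sum_le_sum fun l _ =>
        mul_le_mul_of_nonneg_left (hW k) (afSZero_nonneg hθ 0 k (mem_univ l))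
    have hsum : ∑ k : 𝕋, ∑ l ∈ univ.filter ((torusGraph d L).Adj k), afSZero GT univ θ 0 k l * (deg * B) = D * (deg * B) := by
      rw [hD', sum_mul]
      exact sum_congr rfl fun k _ => by rw [sum_mul]
    rw [hsum] at this
    nlinarith [this, htb0]
  -- Step 5: combine
  have hmain : ∑ u : 𝕋, ∑ v ∈ univ.filter ((torusGraph d L).Adj u), ∑ S ∈ P, clusterWeight GT univ θ 0 u S *
      (M - (Real.tanh (β * h) * ∑ k ∈ univ.filter (fun k : 𝕋 => (some k : Option 𝕋) ∉ S), K v k +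
        ∑ k ∈ univ.filter (fun k : 𝕋 => (some k : Option 𝕋) ∉ S), ∑ l ∈ univ.filter ((torusGraph d L).Adj k),
          K v k * Real.tanh β * corrIn GT univ θ S {l})) ≤ D := by
    rw [hD']
    exact sum_le_sum fun u _ => sum_le_sum fun v _ => step1 u v
  have hsplit : ∑ u : 𝕋, ∑ v ∈ univ.filter ((torusGraph d L).Adj u), ∑ S ∈ P, clusterWeight GT univ θ 0 u S *
      (M - (Real.tanh (β * h) * ∑ k ∈ univ.filter (fun k : 𝕋 => (some k : Option 𝕋) ∉ S), K v k +
        ∑ k ∈ univ.filter (fun k : 𝕋 => (some k : Option 𝕋) ∉ S), ∑ l ∈ univ.filter ((torusGraph d L).Adj k),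
          K v k * Real.tanh β * corrIn GT univ θ S {l})) =
      ∑ u : 𝕋, ∑ v ∈ univ.filter ((torusGraph d L).Adj u), ∑ S ∈ P, clusterWeight GT univ θ 0 u S * M -
        ∑ u : 𝕋, ∑ v ∈ univ.filter ((torusGraph d L).Adj u), ∑ S ∈ P, clusterWeight GT univ θ 0 u S *
          (Real.tanh (β * h) * ∑ k ∈ univ.filter (fun k : 𝕋 => (some k : Option 𝕋) ∉ S), K v k) -
        ∑ u : 𝕋, ∑ v ∈ univ.filter ((torusGraph d L).Adj u), ∑ S ∈ P, clusterWeight GT univ θ 0 u S *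
          (∑ k ∈ univ.filter (fun k : 𝕋 => (some k : Option 𝕋) ∉ S), ∑ l ∈ univ.filter ((torusGraph d L).Adj k),
            K v k * Real.tanh β * corrIn GT univ θ S {l}) := by
    rw [← sum_sub_distrib, ← sum_sub_distrib]
    refine sum_congr rfl fun u _ => ?_
    rw [← sum_sub_distrib, ← sum_sub_distrib]
    refine sum_congr rfl fun v _ => ?_
    rw [← sum_sub_distrib, ← sum_sub_distrib]
    exact sum_congr rfl fun S _ => by ring
  rw [hsplit, stepI] at hmain
  have hMdef : M = torusMag d L β h := rfl
  nlinarith [hmain, stepII, stepIII]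

/-- **Theorem 5.6 of Aizenman–Fernández 1986 on the torus, printed form**: under (K0)–(K2),
`D_L ≥ deg χ_L [M_L - tanh(βh) B_L]₊ / (1 + 2β deg B_L)` (the proof gives the denominator
`1 + tanh(β) deg B_L ≤ 1 + 2β deg B_L`). [cite: AizenmanFernandezJSP1986, §5.2, Theorem 5.6, eq. (5.19), p. 431] -/
theorem torusDbeta_ge_of_kernel {β h : ℝ} (hβ : 0 ≤ β) (hh : 0 ≤ h) (K : 𝕋 → 𝕋 → ℝ)
    (hK0 : ∀ v k, 0 ≤ K v k)
    (hK1 : ∀ S : Finset (Option 𝕋), (none : Option 𝕋) ∈ S → ∀ v : 𝕋,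
      thetaCorr GT univ (ghostCoupling β (β * h)) {v} - corrIn GT univ (ghostCoupling β (β * h)) S {v} ≤
        Real.tanh (β * h) * ∑ k ∈ univ.filter (fun k : 𝕋 => (some k : Option 𝕋) ∉ S), K v k +
          ∑ k ∈ univ.filter (fun k : 𝕋 => (some k : Option 𝕋) ∉ S),
            ∑ l ∈ univ.filter ((torusGraph d L).Adj k),
              K v k * Real.tanh β * corrIn GT univ (ghostCoupling β (β * h)) S {l})
    (hK2 : ∀ v k, K v k ≤ isingTorusTwoPoint d L β 0 v k) :
    ((univ.filter ((torusGraph d L).Adj (0 : 𝕋))).card : ℝ) * torusSusc d L β h *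
          max (torusMag d L β h - Real.tanh (β * h) * torusBubble d L β) 0 /
        (1 + 2 * β * ((univ.filter ((torusGraph d L).Adj (0 : 𝕋))).card : ℝ) * torusBubble d L β) ≤
      torusDbeta d L β h := by
  have hmain := torusDbeta_mul_ge_of_kernel hβ hh K hK0 hK1 hK2
  set deg : ℝ := ((univ.filter ((torusGraph d L).Adj (0 : 𝕋))).card : ℝ) with hdeg
  have hdeg0 : 0 ≤ deg := Nat.cast_nonneg _
  have hB0 : 0 ≤ torusBubble d L β := sum_nonneg fun y _ => sq_nonneg _
  have hχ0 : 0 ≤ torusSusc d L β h := (torusSusc_pos hβ hh).le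
  have hD0 : 0 ≤ torusDbeta d L β h := torusDbeta_nonneg hβ hh
  have htb0 : 0 ≤ Real.tanh β := by
    rw [Real.tanh_eq_sinh_div_cosh]
    exact div_nonneg (Real.sinh_nonneg_iff.2 hβ) (Real.cosh_pos _).le
  have htb1 : Real.tanh β ≤ β := Literature.Barriers.HubbardSuperconductivity.tanh_le_self hβ
  have hden1 : 0 < 1 + Real.tanh β * deg * torusBubble d L β := by positivity
  have hden2 : 0 < 1 + 2 * β * deg * torusBubble d L β := by positivity
  have hden12 : 1 + Real.tanh β * deg * torusBubble d L β ≤ 1 + 2 * β * deg * torusBubble d L β := by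
    nlinarith [mul_nonneg hdeg0 hB0, hβ]
  rw [div_le_iff₀ hden2]
  rcases le_or_gt (torusMag d L β h - Real.tanh (β * h) * torusBubble d L β) 0 with hneg | hpos
  · rw [max_eq_right hneg, mul_zero]
    exact mul_nonneg hD0 hden2.le
  · rw [max_eq_left hpos.le]
    calc deg * torusSusc d L β h * (torusMag d L β h - Real.tanh (β * h) * torusBubble d L β)
        ≤ torusDbeta d L β h * (1 + Real.tanh β * deg * torusBubble d L β) := hmain
      _ ≤ torusDbeta d L β h * (1 + 2 * β * deg * torusBubble d L β) :=
          mul_le_mul_of_nonneg_left hden12 hD0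

end Torus

end Literature.Probability.LatticeModels
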